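import Summits.QuantumFields.BalabanUV.T4Continuum.Support.NE3CovariantLineSumsL2TowerSharp
import HarnessLib

/-!
# T⁴ programme, node NE3, route (H♮) row H4-W (= K5-spk) — THE SHARP FRAME BOUND AT A CURVED BACKGROUND IN THE CLASS ALONE (H4-W♯♯):
# `Σ_{z∈periodBox N} ‖framePotW L (j+1) W Y z‖² ≤ 48·(d·L)·l2sq (periodBox (L^{j+1}·N)) Y` WITHOUT the level-sum hypothesis `S2sum ≤ ρ∕2`

NE3 formalisation swarm `b2b-balaban-t4-ne3-formalise-*`, LEAF PROVER 04 (gen 6), file 3∕3 of this seat's «C1-L2♯».  H4-W (`NE3FramePotBoundW`, p232724) and its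
sharpening H4-W♯ (`NE3FramePotBoundWSharp`, p234726) carry the class hypothesis `hS : S2sum d L (j+1) x ≤ rho d L ∕ 2`, inherited from C1 file 5's ℓ²
error tower; with the crude box constant `C2sq` that line is NOT implied by the tower class `LevelSmall` (`S2sum` up to ≈ 11.8 ≫ ρ∕2 = 0.25 at d = 4,
L = 2).  File 5♯ (`NE3CovariantLineSumsL2TowerSharp`, this seat) proved the error tower WITHOUT that line: `sqrt_l2sq_ErrIter_le_of_levelSmall :
√l2sq_N (ErrIter L (j+1) W Y) ≤ ρ^{j+1}·√l2sq Y` under `LevelSmall` alone (`L ≥ 2`).  THIS FILE re-runs H4-W♯ §3–§4 over it: the level-`m` field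
`QbarIter = QstrIter + ErrIter` carries `(ρ^m + ρ^m)² = 4·(L²∕L^d)^m` (the SAME constant 4 as H4-W), the block-local one-level frame bound
`NE3FramePotBoundSharp.sum_norm_Fbar_sq_le_torus` (d·L), Sedrakyan with weights `(3∕4)^m` — and the END has H4-W♯'s binders MINUS `hS`.

CONTENT (all [folklore]; 0 sorry; 0 def): `l2sq_QbarIter_succ_le_class`, `l2sq_QbarIter_le_class`, `sum_norm_Fbar_QbarIter_sq_le_class` and the END
**`sum_norm_framePotW_sq_le_class [Nonempty n] (hd : 3 ≤ d) (hL : 2 ≤ L) (hN : 1 ≤ N) j (hWu) (hWP) (hx) (hsm : LevelSmall d L j x) (hWx : SmallField W x) (hY) :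
Σ_{z∈periodBox N} ‖framePotW L (j+1) W Y z‖² ≤ 48·((d:ℝ)·L)·l2sq (periodBox (L^(j+1)·N)) Y`** — the curved frame bound of route H♮ with NO smallness
hypothesis beyond the tower class (k-FREE, N-FREE; d = 4, L = 2: 384).

HONEST FRAMING.  Lattice kinematics on OUR frame; one displayed smallness line of the (P♮)_W census removed (for the consumers that switch to this END),
nothing else; nothing about Bałaban's minimisers; (P♮)_W, (ML_w) at W ≠ 1, T-E_w and NE3 are NOT proved; spine PROVED 0∕9; finite T⁴ rung (B)+1 — NOT
infinite volume, NOT mass gap, NOT BetaPertH, NOT Clay.  ABSOLUTE RULE kept (no printed sentence is a hypothesis).  PLACEMENT: `Summits/QuantumFields/BalabanUV/`.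
HONEST DEPENDENCY: continuum YM on T⁴ ⇐ BetaPertH ∧ nine spine estimates (0/9 proved); BetaPertH ⇐ (D1) ∧ (D4) ∧ CAP+tail; G-an2-4 gates asym, D1 and NE2/3/4.
-/

set_option autoImplicit false

open scoped BigOperators Matrix.Norms.L2Operator
open Finset

namespace Summit.QuantumFields.BalabanUV.T4Continuum.NE3FramePotBoundWClass

open Literature.MathematicalPhysics.QuantumFieldTheory.Balaban1983to89
open B7Prop1Explicit B7Prop2Explicit
open T4AveragingDeficitWall (IsUnitaryCfg SmallField)
open T4AveragingDeficitWallBoundary (periodBox IsPeriodicCfg)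
open AveragingDeficitPeriodicCounting (IsPeriodicDir)
open AveragingDeficitMultiLevelPrep (cavgIter tower LevelSmall cavgIter_unitary_small)
open NE3TangentCovariantStructure (Fbar)
open NE3TangentCovariantTower (QbarIter framePotW QbarIter_zero)
open NE3CovariantLineSumsTower (QbarIter_eq_QstrIter_add_ErrIter)
open NE3CovariantLineSumsL2 (l2sq l2sq_nonneg sqrt_l2sq_add_le)
open NE3CovariantLineSumsL2Tower (rho rho_nonneg sqrt_l2sq_QstrIter_le)
open NE3CovariantLineSumsL2TowerSharp (sqrt_l2sq_ErrIter_le_of_levelSmall)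
open NE3FramePotBound (ratio_le geom_sum_le_inv)
open NE3FramePotBoundW (framePotW_eq_sum tower_eq_pow_mul levelSmall_of_le isPeriodicDir_QbarIter)
open NE3FramePotBoundSharp (sum_norm_Fbar_sq_le_torus)

noncomputable section

variable {d : ℕ} {n : Type*} [Fintype n] [DecidableEq n]

/-! ## §1 The level-`m` field in ℓ²(torus) in the class alone -/

/-- **THE k-FOLD LINEARISED AVERAGE IN ℓ²(TORUS), CLASS ONLY** (`L ≥ 2`): `l2sq_P (QbarIter L (m+1) W Y) ≤ 4·(L²∕L^d)^{m+1}·l2sq_{tower L P (m+1)} Y`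
(`QbarIter = QstrIter + ErrIter`, both towers weigh `ρ^{m+1}` — the error tower by `sqrt_l2sq_ErrIter_le_of_levelSmall`). [folklore] -/
theorem l2sq_QbarIter_succ_le_class [Nonempty n] {L P : ℕ} (hL : 2 ≤ L) (hP : 1 ≤ P) (m : ℕ) {W : Site d → Fin d → (Matrix n n ℂ)ˣ}
    {x : ℝ} (hWu : IsUnitaryCfg W) (hWP : IsPeriodicCfg W ((tower L P (m + 1) : ℕ) : ℤ)) (hx : 0 ≤ x) (hsm : LevelSmall d L m x)
    (hWx : SmallField W x) {Y : Site d → Fin d → Matrix n n ℂ} (hY : IsPeriodicDir Y ((tower L P (m + 1) : ℕ) : ℤ)) :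
    l2sq (periodBox (d := d) P) (QbarIter L (m + 1) W Y)
      ≤ 4 * ((L : ℝ) ^ 2 / (L : ℝ) ^ d) ^ (m + 1) * l2sq (periodBox (d := d) (tower L P (m + 1))) Y := by
  have hL1 : 1 ≤ L := by omega
  have hρ := rho_nonneg d L
  set nY : ℝ := Real.sqrt (l2sq (periodBox (d := d) (tower L P (m + 1))) Y) with hnY
  have hnY0 : 0 ≤ nY := Real.sqrt_nonneg _
  have h1 := sqrt_l2sq_QstrIter_le hL1 hP m hWu hWP hx hsm hWx hY
  have h2 := sqrt_l2sq_ErrIter_le_of_levelSmall hL hP m hWu hWP hx hsm hWx hY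
  have hsum : Real.sqrt (l2sq (periodBox (d := d) P) (QbarIter L (m + 1) W Y)) ≤ 2 * rho d L ^ (m + 1) * nY := by
    rw [QbarIter_eq_QstrIter_add_ErrIter hL1 m hWu hx hsm hWx Y]
    refine (sqrt_l2sq_add_le _ _ _).trans ((add_le_add h1 h2).trans ?_)
    linarith
  have hl0 : 0 ≤ l2sq (periodBox (d := d) P) (QbarIter L (m + 1) W Y) := l2sq_nonneg _ _
  have hρ2 : rho d L ^ 2 = (L : ℝ) ^ 2 / (L : ℝ) ^ d := by
    unfold rho; rw [Real.sq_sqrt (by positivity)]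
  calc l2sq (periodBox (d := d) P) (QbarIter L (m + 1) W Y)
      = Real.sqrt (l2sq (periodBox (d := d) P) (QbarIter L (m + 1) W Y)) ^ 2 := (Real.sq_sqrt hl0).symm
    _ ≤ (2 * rho d L ^ (m + 1) * nY) ^ 2 := pow_le_pow_left₀ (Real.sqrt_nonneg _) hsum 2
    _ = 4 * (rho d L ^ 2) ^ (m + 1) * nY ^ 2 := by ring
    _ = 4 * ((L : ℝ) ^ 2 / (L : ℝ) ^ d) ^ (m + 1) * l2sq (periodBox (d := d) (tower L P (m + 1))) Y := by
        rw [hρ2, hnY, Real.sq_sqrt (l2sq_nonneg _ _)]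

/-- The level-`m` field in ℓ², all `m` (`m = 0` trivial), smallness from a dominating level `j ≥ m − 1`, class only. [folklore] -/
theorem l2sq_QbarIter_le_class [Nonempty n] {L P : ℕ} (hL : 2 ≤ L) (hP : 1 ≤ P) {j : ℕ} (m : ℕ) (hmj : m ≤ j + 1)
    {W : Site d → Fin d → (Matrix n n ℂ)ˣ} {x : ℝ} (hWu : IsUnitaryCfg W) (hWP : IsPeriodicCfg W ((L ^ m * P : ℕ) : ℤ)) (hx : 0 ≤ x)
    (hsm : LevelSmall d L j x) (hWx : SmallField W x) {Y : Site d → Fin d → Matrix n n ℂ}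
    (hY : IsPeriodicDir Y ((L ^ m * P : ℕ) : ℤ)) :
    l2sq (periodBox (d := d) P) (QbarIter L m W Y) ≤ 4 * ((L : ℝ) ^ 2 / (L : ℝ) ^ d) ^ m * l2sq (periodBox (d := d) (L ^ m * P)) Y := by
  cases m with
  | zero =>
      rw [QbarIter_zero, pow_zero, mul_one, pow_zero, one_mul]
      have h0 := l2sq_nonneg (periodBox (d := d) P) Y
      linarith
  | succ m =>
      rw [← tower_eq_pow_mul] at hWP hY ⊢
      exact l2sq_QbarIter_succ_le_class hL hP m hWu hWP hx (levelSmall_of_le (by omega) hsm) hWx hY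

/-! ## §2 One term on the torus and the END, class only -/

/-- **ONE TERM ON THE TORUS, CLASS ONLY**: for `j + 1 + m` levels,
`Σ_{z∈periodBox N} ‖Fbar L (cavgIter L m W) (QbarIter L m W Y) ((L^j)•z)‖² ≤ 4·(d·L)·(L²∕L^d)^m·l2sq (periodBox (L^{j+1+m}·N)) Y`. [folklore] -/
theorem sum_norm_Fbar_QbarIter_sq_le_class [Nonempty n] {L : ℕ} (hL : 2 ≤ L) {N : ℕ} (hN : 1 ≤ N) (j m : ℕ) {i : ℕ} (hmi : m ≤ i + 1)
    {W : Site d → Fin d → (Matrix n n ℂ)ˣ} {x : ℝ} (hWu : IsUnitaryCfg W) (hWP : IsPeriodicCfg W ((L ^ (j + 1 + m) * N : ℕ) : ℤ))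
    (hx : 0 ≤ x) (hsm : LevelSmall d L i x) (hWx : SmallField W x)
    {Y : Site d → Fin d → Matrix n n ℂ} (hY : IsPeriodicDir Y ((L ^ (j + 1 + m) * N : ℕ) : ℤ)) :
    ∑ z ∈ periodBox (d := d) N, ‖Fbar L (cavgIter L m W) (QbarIter L m W Y) (((L : ℤ) ^ j) • z)‖ ^ 2
      ≤ 4 * ((d : ℝ) * L) * ((L : ℝ) ^ 2 / (L : ℝ) ^ d) ^ m * l2sq (periodBox (d := d) (L ^ (j + 1 + m) * N)) Y := by
  have hL1 : 1 ≤ L := by omega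
  have hPe : L ^ (j + 1 + m) * N = L ^ m * (L ^ (j + 1) * N) := by ring
  have hP : 1 ≤ L ^ (j + 1) * N := Nat.one_le_iff_ne_zero.mpr (Nat.mul_ne_zero (pow_ne_zero _ (by omega)) (by omega))
  have hUu : IsUnitaryCfg (cavgIter L m W) := by
    cases m with
    | zero => exact hWu
    | succ m => exact (cavgIter_unitary_small hL1 m hWu hx (levelSmall_of_le (by omega) hsm) hWx).1
  have h1 := sum_norm_Fbar_sq_le_torus (d := d) hL1 j N hUu (QbarIter L m W Y)
  have hl2 := l2sq_QbarIter_le_class (d := d) hL hP m hmi hWu (by rw [← hPe]; exact hWP) hx hsm hWx (Y := Y) (by rw [← hPe]; exact hY)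
  rw [← hPe] at hl2
  calc ∑ z ∈ periodBox (d := d) N, ‖Fbar L (cavgIter L m W) (QbarIter L m W Y) (((L : ℤ) ^ j) • z)‖ ^ 2
      ≤ ((d : ℝ) * L) * l2sq (periodBox (d := d) (L ^ (j + 1) * N)) (QbarIter L m W Y) := h1
    _ ≤ ((d : ℝ) * L) * (4 * ((L : ℝ) ^ 2 / (L : ℝ) ^ d) ^ m * l2sq (periodBox (d := d) (L ^ (j + 1 + m) * N)) Y) :=
        mul_le_mul_of_nonneg_left hl2 (by positivity)
    _ = 4 * ((d : ℝ) * L) * ((L : ℝ) ^ 2 / (L : ℝ) ^ d) ^ m * l2sq (periodBox (d := d) (L ^ (j + 1 + m) * N)) Y := by ring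

/-- **H4-W♯♯ — THE SHARP FRAME BOUND AT A CURVED BACKGROUND IN THE CLASS ALONE**: for `3 ≤ d`, `2 ≤ L`, `1 ≤ N`, a unitary `(L^{j+1}·N)`-periodic `W`
with `0 ≤ x`, `LevelSmall d L j x`, `SmallField W x`, and an `(L^{j+1}·N)`-periodic `Y`:
`Σ_{z∈periodBox N} ‖framePotW L (j+1) W Y z‖² ≤ 48·(d·L)·Σ_{x∈periodBox (L^{j+1}·N)} Σ_κ ‖Y x κ‖²` — H4-W♯'s `sum_norm_framePotW_sq_le_sharp` (p234726) WITHOUT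
the binder `hS : S2sum d L (j+1) x ≤ rho d L ∕ 2` (k-FREE, N-FREE; d = 4, L = 2: 384). [folklore] -/
theorem sum_norm_framePotW_sq_le_class [Nonempty n] (hd : 3 ≤ d) {L : ℕ} (hL : 2 ≤ L) {N : ℕ} (hN : 1 ≤ N) (j : ℕ)
    {W : Site d → Fin d → (Matrix n n ℂ)ˣ} {x : ℝ} (hWu : IsUnitaryCfg W) (hWP : IsPeriodicCfg W ((L ^ (j + 1) * N : ℕ) : ℤ))
    (hx : 0 ≤ x) (hsm : LevelSmall d L j x) (hWx : SmallField W x)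
    {Y : Site d → Fin d → Matrix n n ℂ} (hY : IsPeriodicDir Y ((L ^ (j + 1) * N : ℕ) : ℤ)) :
    ∑ z ∈ periodBox (d := d) N, ‖framePotW L (j + 1) W Y z‖ ^ 2 ≤ 48 * ((d : ℝ) * L) * l2sq (periodBox (d := d) (L ^ (j + 1) * N)) Y := by
  have hD0 : 0 ≤ (d : ℝ) * L := by positivity
  have hS0 : 0 ≤ l2sq (periodBox (d := d) (L ^ (j + 1) * N)) Y := l2sq_nonneg _ _
  set k : ℕ := j + 1 with hk
  have hkpos : 0 < k := by omega
  -- notation: the terms `a m z` and the weights `w m = (3/4)^m`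
  set ρ2 : ℝ := (L : ℝ) ^ 2 / (L : ℝ) ^ d with hρ2
  have hρ0 : 0 ≤ ρ2 := by rw [hρ2]; positivity
  have hρq : ρ2 * (4 / 3) ≤ 2 / 3 := ratio_le (d := d) hd hL
  set a : ℕ → Site d → ℝ := fun m z => ‖Fbar L (cavgIter L m W) (QbarIter L m W Y) (((L : ℤ) ^ (k - 1 - m)) • z)‖ with ha
  set w : ℕ → ℝ := fun m => (3 / 4 : ℝ) ^ m with hw
  have hwpos : ∀ m ∈ range k, 0 < w m := fun m _ => by rw [hw]; positivity
  have hwsum : ∑ m ∈ range k, w m ≤ 4 := by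
    have := geom_sum_le_inv (q := (3 / 4 : ℝ)) (by norm_num) (by norm_num) k
    simpa [hw] using this.trans (by norm_num)
  have hwsum0 : 0 < ∑ m ∈ range k, w m := Finset.sum_pos hwpos ⟨0, Finset.mem_range.mpr hkpos⟩
  -- (1) pointwise: `‖framePotW‖ ≤ Σ_m a m z` and Sedrakyan
  have hpt : ∀ z : Site d, ‖framePotW L k W Y z‖ ^ 2 ≤ 4 * ∑ m ∈ range k, a m z ^ 2 / w m := by
    intro z
    have h1 : ‖framePotW L k W Y z‖ ≤ ∑ m ∈ range k, a m z := by
      rw [framePotW_eq_sum]; exact norm_sum_le _ _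
    have h2 := Finset.sq_sum_div_le_sum_sq_div (range k) (fun m => a m z) hwpos
    have h3 : (∑ m ∈ range k, a m z) ^ 2 ≤ (∑ m ∈ range k, w m) * ∑ m ∈ range k, a m z ^ 2 / w m := by
      rw [div_le_iff₀ hwsum0] at h2; linarith [h2]
    have h4 : 0 ≤ ∑ m ∈ range k, a m z ^ 2 / w m :=
      Finset.sum_nonneg fun m hm => div_nonneg (sq_nonneg _) (hwpos m hm).le
    calc ‖framePotW L k W Y z‖ ^ 2 ≤ (∑ m ∈ range k, a m z) ^ 2 := pow_le_pow_left₀ (norm_nonneg _) h1 2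
      _ ≤ (∑ m ∈ range k, w m) * ∑ m ∈ range k, a m z ^ 2 / w m := h3
      _ ≤ 4 * ∑ m ∈ range k, a m z ^ 2 / w m := mul_le_mul_of_nonneg_right hwsum h4
  -- (2) the torus sum of each weighted term
  have hterm : ∀ m ∈ range k, ∑ z ∈ periodBox (d := d) N, a m z ^ 2 / w m
      ≤ 4 * ((d : ℝ) * L) * (2 / 3 : ℝ) ^ m * l2sq (periodBox (d := d) (L ^ k * N)) Y := by
    intro m hm
    have hmk : m < k := Finset.mem_range.mp hm
    have hjm : k - 1 - m + 1 + m = k := by omega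
    have hWP' : IsPeriodicCfg W ((L ^ (k - 1 - m + 1 + m) * N : ℕ) : ℤ) := by rw [hjm]; exact hWP
    have hY' : IsPeriodicDir Y ((L ^ (k - 1 - m + 1 + m) * N : ℕ) : ℤ) := by rw [hjm]; exact hY
    have h := sum_norm_Fbar_QbarIter_sq_le_class (d := d) hL hN (k - 1 - m) m (i := j) (by omega) hWu hWP' hx hsm hWx hY'
    rw [hjm] at h
    rw [← Finset.sum_div]
    have hw' : w m = (3 / 4 : ℝ) ^ m := rfl
    rw [div_le_iff₀ (hwpos m hm), hw']
    have hD4 : 0 ≤ 4 * ((d : ℝ) * L) := by positivity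
    calc ∑ z ∈ periodBox (d := d) N, a m z ^ 2 ≤ 4 * ((d : ℝ) * L) * ρ2 ^ m * l2sq (periodBox (d := d) (L ^ k * N)) Y := h
      _ ≤ 4 * ((d : ℝ) * L) * ((2 / 3 : ℝ) ^ m * (3 / 4 : ℝ) ^ m)⁻¹⁻¹ * l2sq (periodBox (d := d) (L ^ k * N)) Y := by
          rw [inv_inv]
          refine mul_le_mul_of_nonneg_right (mul_le_mul_of_nonneg_left ?_ hD4) hS0
          rw [← mul_pow]
          exact pow_le_pow_left₀ hρ0 (by nlinarith) m
      _ = 4 * ((d : ℝ) * L) * (2 / 3 : ℝ) ^ m * l2sq (periodBox (d := d) (L ^ k * N)) Y * (3 / 4 : ℝ) ^ m := by rw [inv_inv]; ring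
  -- (3) assemble
  have hgeo : ∑ m ∈ range k, (2 / 3 : ℝ) ^ m ≤ 3 := by
    have := geom_sum_le_inv (q := (2 / 3 : ℝ)) (by norm_num) (by norm_num) k
    exact this.trans (by norm_num)
  calc ∑ z ∈ periodBox (d := d) N, ‖framePotW L k W Y z‖ ^ 2
      ≤ ∑ z ∈ periodBox (d := d) N, 4 * ∑ m ∈ range k, a m z ^ 2 / w m := Finset.sum_le_sum fun z _ => hpt z
    _ = 4 * ∑ m ∈ range k, ∑ z ∈ periodBox (d := d) N, a m z ^ 2 / w m := by rw [← Finset.mul_sum, Finset.sum_comm]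
    _ ≤ 4 * ∑ m ∈ range k, 4 * ((d : ℝ) * L) * (2 / 3 : ℝ) ^ m * l2sq (periodBox (d := d) (L ^ k * N)) Y :=
        mul_le_mul_of_nonneg_left (Finset.sum_le_sum hterm) (by norm_num)
    _ = 16 * (((d : ℝ) * L) * l2sq (periodBox (d := d) (L ^ k * N)) Y) * ∑ m ∈ range k, (2 / 3 : ℝ) ^ m := by
        simp only [Finset.mul_sum]; exact Finset.sum_congr rfl fun m _ => by ring
    _ ≤ 16 * (((d : ℝ) * L) * l2sq (periodBox (d := d) (L ^ k * N)) Y) * 3 :=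
        mul_le_mul_of_nonneg_left hgeo (by positivity)
    _ = 48 * ((d : ℝ) * L) * l2sq (periodBox (d := d) (L ^ k * N)) Y := by ring

end

end Summit.QuantumFields.BalabanUV.T4Continuum.NE3FramePotBoundWClass
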